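import Summits.Langlands.Langlands.Theses.EisensteinGelfandKirillov
import Summits.Langlands.Langlands.Theorems.ProModularOrdinaryClassical.Negative.LoadBearing
import Summits.Langlands.Langlands.Theorems.ProModularOrdinaryClassical.Negative.FrobeniusIntegrality
import Summits.Langlands.Langlands.Theorems.ProModularOrdinaryClassical.Negative.DeterminantShadow
import Summits.Langlands.Langlands.Theorems.EisensteinProModularSeed.Negative.BorelAndEisenstein
import Literature.FieldTheory.AlgClosed.PadicAlgClEquivComplex

/-!
# Disproof of `CrystallineProModularClassical` (stmt-Langlands-18274) — standing disprover's work file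

Crux: `Summit.Langlands.Langlands.Theses.EisensteinGelfandKirillov.CrystallineProModularClassical`
(route EisensteinGelfandKirillov, rank 4, THE EXIT): `F` totally real, `p ≥ 5`, `p ∤ disc F`;
every irreducible, totally odd, a.e.-unramified `ρ : Γ_F → GL₂(ℚ̄_p)` that is `p`-adically
automorphic of some tame level (`∃ 𝒰, 𝒰.IsPadicallyAutomorphic ρ`) and, at every `v ∣ p`,
CRYSTALLINE for Fontaine's pinned datum `fontainePstAdicCompletion v p hv` with pairwise distinct
`τ`-labelled Hodge–Tate weights, is classical: `∃ π` cuspidal L-algebraic on `GL₂(𝔸_F)` with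
Satake–Frobenius matching at almost all `v`.

**cdisprove gen 1, cycle 1** (2026-08-17). VERDICT: **no kill — and none is possible short of a
refutation of the summit `Langlands` itself**: `crux_of_langlands : Langlands → crux` (§0) is a
three-line theorem, because the crux's `p`-adic Hodge datum IS the summit's pinned datum
(`ReciprocityData.pst` is by definition `fontainePstAdicCompletion`, and crystalline ⇒ de Rham is
`IsCrystallineFramed.isDeRhamFramed`), so an irreducible crystalline a.e.-unramified `ρ` is
`IsGeometricFramed 𝓡 ρ` for every `𝓡` and conjunct (B) of the summit hands over the cuspidal `π`.
Every hypothesis of the crux other than {irreducible, de Rham at `v ∣ p`, a.e. unramified} —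
pro-modularity, total oddness, labelled HT-regularity, `5 ≤ p`, `p ∤ disc F`, `F` totally real,
"crystalline" beyond "de Rham" — can be deleted and the result is STILL a corollary of `Langlands`
(`fontaineMazurSector_of_langlands`, §0–§1): so no `_false_without_H` theorem exists for any of
these `H` unless the summit is false. They are load-bearing for the METHOD (small-slope /
locally-analytic classicality in cohomological weight at an unramified prime), not for truth.
The two hypotheses that ARE load-bearing for truth — irreducibility and crystallinity at `v ∣ p` —
have honest paper witnesses (§1g, §1h) that are not Lean-constructible today (no Hecke eigensystem
of the constructed tower `H^•(X_{U_r}, ℤ/p^s)` is unfolded in the tree; no irreducible `ρ` can be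
CERTIFIED crystalline for the `ε`-pinned datum, whose Weil–Deligne half is pinned by specification).

LANDED this cycle (p143378 ACCEPTED, commit ec785f236eb7):
`Summits/Langlands/Langlands/Theorems/CrystallineProModularClassical/Negative/LoadBearing.lean`
(namespace `…Theorems.CrystallineProModularClassical.Negative`): `satakeConclusion_of_langlands`,
`satakeConclusion_of_langlands_of_isCrystallineFramed`, `nodup_jumpMultiset_of_forall_sub_le_one`,
`sub_le_one_of_nodup_jumpMultiset`, `jumpMultiset_eq_zero_of_forall_eq`,
`isLabelledHodgeTateRegular_of_forall_finrank_succ_eq`, `labelledHodgeTateWeights_eq_zero_of_forall_finrank_succ_eq`,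
`isLabelledHodgeTateRegular_of_coeffD_eq_bot`, `hreg_of_coeffD_eq_bot` — ideators/planners may IMPORT that module;
this work file still carries its own checked copies (namespace `…Cruxes.CrystallineProModularClassical.Disproof`)
and will switch to the import at the next cycle (v2 prepared in the seat folder, pending the farm build).

## Findings index (everything below is `lean check`ed; no `sorry`)
* §0 `satakeConclusion_of_langlands`, `crux_of_langlands`, `not_langlands_of_not_crux`,
  `FontaineMazurSector` (= the crux with EVERY non-Fontaine–Mazur hypothesis deleted: any number
  field, any prime, no oddness, no regularity, no pro-modularity, de Rham instead of crystalline),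
  `fontaineMazurSector_of_langlands`, `crux_of_fontaineMazurSector` — the crux sits between the
  summit and itself along a chain of pure weakenings: `Langlands → FontaineMazurSector → crux`.
* §1 LOAD-BEARING ANALYSIS, hypothesis by hypothesis:
  - §1a `WithoutUnramified`, `crux_iff_withoutUnramified`: `hunr` is implied by pro-modularity
    (landed sibling lemma `eventually_isUnramifiedAt_of_isPadicallyAutomorphic`) — decoration.
  - §1b–§1f `WithoutProModular`, `WithoutOdd`, `WithoutHTRegular`, `WithoutBaseConditions`,
    `WithDeRham`: each is a strengthening of the crux (`crux_of_…`) AND a weakening of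
    `FontaineMazurSector` (`…_of_fontaineMazurSector`), hence implied by `Langlands`: NOT
    load-bearing for truth. Docstrings record what each buys the METHOD.
  - §1d' `nodup_jumpMultiset_of_forall_sub_le_one`, `jumpMultiset_eq_zero_of_forall_eq`,
    `isLabelledHodgeTateRegular_of_forall_finrank_succ_eq`, `isLabelledHodgeTateRegular_of_coeffD_eq_bot`,
    `hreg_of_coeffD_eq_bot`: "labelled-HT-regular" AS TYPED (`Nodup` of the jump multiset) is
    VACUOUSLY TRUE for a `ρ` with no de Rham periods (`D_τ = 0` ⇒ `HT_τ = ∅`): the regularity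
    conjunct of `hloc` has content only together with the crystalline conjunct — the paper
    witnesses against `WithoutCrystalline` (§1h) satisfy it for free.
  - §1g `WithoutIrreducible` (def; paper-false: the `H⁰`/Eisenstein point `1 ⊕ ε` is pro-modular,
    crystalline with labelled weights `{0,-1}`, odd, unramified outside `p`, and matches no
    cuspidal `π` — Jacquet–Shalika); formal half `not_isIrreducible_of_borelFrame`,
    `heckeFrobPoly_two_eisenstein` (imports). LOAD-BEARING for truth.
  - §1h `WithoutCrystalline` (def; paper-false INSIDE the crux's range `F = ℚ`: the cyclotomic
    twist family `ρ_f ⊗ ⟨ε⟩^t`, `2t ∉ ℤ`, is pro-modular of the same tame level, irreducible, odd,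
    "regular" as typed (§1d'), not de Rham, and matches no L-algebraic `π` by the determinant
    shadow `exists_heckeCharacter_of_satakeConclusion` (landed sibling lemma: the conclusion makes
    `ι ∘ det ρ` the Satake shadow of a Hecke character, algebraic for L-algebraic `π`)).
    LOAD-BEARING for truth; `crux_of_withoutCrystalline`.
* §2 NATURAL STRENGTHENINGS: `WithAllPlaces` (Satake matching at EVERY `v`: false as soon as `ρ`
  ramifies somewhere, since `SatakeFrobCompatibleAt` contains `ρ.IsUnramifiedAt v`; paper witness
  any ramified classical `ρ`; `withAllPlaces_false_of_witness` = the formal half).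
* §3 NON-VACUITY of every binder: `baseConditions_rat` (`F = ℚ`, any prime `p ≥ 5` meets
  "totally real, `5 ≤ p`, `p ∤ disc`"), `iota_nonempty`, `hcpt_holds`, `tameLevel_nonempty`;
  `CruxOverQ`, `cruxOverQ_of_crux` (the `F = ℚ` slice is INSIDE the crux: it is Emerton 2011
  Thm. 1.2.4 / Pan, Ann. Math. 203 (2026) "locally analytic vectors II" — in print).
* §4 STRUCTURE OF WOULD-BE WITNESSES (imports, sibling crux `ProModularOrdinaryClassical`):
  `hpm_point_integral`, `norm_trace_det_frob_le_one` (pro-modular points are integral),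
  `exists_heckeCharacter_of_satakeConclusion` (determinant shadow).
* §5 ATTACK LOG and WHY IT RESISTS (docstring at the end).

Imported negative knowledge (landed, general number field `F`): from
`Theorems/ProModularOrdinaryClassical/Negative/{LoadBearing,FrobeniusIntegrality,DeterminantShadow}`
(p72520, p77221, p77771) and `Theorems/EisensteinProModularSeed/Negative/BorelAndEisenstein` (p75392).
-/

set_option linter.dupNamespace false

universe u v v' w

namespace Summit.Langlands.Langlands.Cruxes.CrystallineProModularClassical.Disproof

open Summit.Langlands.Langlands.Theses.EisensteinGelfandKirillov
open Summit.Langlands.Langlands.Theorems.ProModularOrdinaryClassical.Negative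
open Summit.Langlands.Langlands.Theorems.EisensteinProModularSeed.Negative
  (not_isIrreducible_of_conj_upperTriangular)
open Literature.NumberTheory.Automorphic Literature.NumberTheory.GaloisRepresentations
open Literature.NumberTheory.Automorphic.BigHeckeGLn Literature.NumberTheory.PAdicHodge
open NumberField IsDedekindDomain Filter Topology Polynomial

/-! ## §0 Position of the crux: a corollary of the summit -/

/-- **The crux's conclusion from the SUMMIT, one `ρ` at a time.** For ANY number field `F`, any
`n ≥ 1`, any prime `p`, any `ρ : Γ_F → GL_n(ℚ̄_p)` irreducible, a.e. unramified and DE RHAM at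
every `v ∣ p` for the pinned datum `fontainePstAdicCompletion v p hv`: `Langlands` gives an
L-algebraic cuspidal `π` with Satake–Frobenius matching at almost all `v`. Proof: `Langlands F`
provides reciprocity data `𝓡` and conjunct (B) `GaloisToAutomorphic n 𝓡 hcpt`; `𝓡.pst p v hv` is
BY DEFINITION the pinned datum, so the hypotheses are `IsGeometricFramed 𝓡 ρ` verbatim
(`satakeConclusion_of_galoisToAutomorphic`, landed). [folklore] -/
theorem satakeConclusion_of_langlands (hL : _root_.Langlands) {n : ℕ} (hn : 0 < n)
    {F : Type} [Field F] [NumberField F] {p : ℕ} [Fact p.Prime]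
    (hcpt : isCompact_glFiniteIntegralLevel n F) (ι : PadicAlgCl p ≃+* ℂ)
    (ρ : FramedGaloisRep F (PadicAlgCl p) n) (hirr : ρ.toGaloisRep.IsIrreducible)
    (hunr : ∀ᶠ v in cofinite, ρ.IsUnramifiedAt v)
    (hdR : ∀ (v : HeightOneSpectrum (𝓞 F)) (hv : ((p : ℕ) : 𝓞 F) ∈ v.asIdeal),
      (fontainePstAdicCompletion v p hv).IsDeRhamFramed (ρ.toLocal v)) :
    ∃ π : CuspidalAutomorphicRepData n F hcpt, π.1.IsLAlgebraic ∧
      ∀ᶠ v in cofinite, Summit.Langlands.SatakeFrobCompatibleAt ι π.1 ρ v := by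
  obtain ⟨⟨𝓡⟩, h𝓡⟩ := hL F
  exact satakeConclusion_of_galoisToAutomorphic hcpt 𝓡 (h𝓡 𝓡 n hn hcpt).2 ι ρ hirr
    ⟨hunr, fun v hv => hdR v hv⟩

/-- **The crux is a corollary of the summit**: `Langlands → CrystallineProModularClassical`.
Only irreducibility, a.e.-unramifiedness and crystalline ⇒ de Rham
(`IsCrystallineFramed.isDeRhamFramed`) are used; oddness, regularity, pro-modularity, `5 ≤ p`,
`p ∤ disc F` and total reality are discarded. [folklore] -/
theorem crux_of_langlands (hL : _root_.Langlands) : CrystallineProModularClassical := by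
  intro F _ _ _ p _ _ _ hcpt ι ρ hirr _ hunr _ hloc
  exact satakeConclusion_of_langlands hL two_pos hcpt ι ρ hirr hunr
    fun v hv => (hloc v hv).1.isDeRhamFramed

/-- **Any kill of the crux is a kill of the summit.** [folklore] -/
theorem not_langlands_of_not_crux (h : ¬ CrystallineProModularClassical) : ¬ _root_.Langlands :=
  fun hL => h (crux_of_langlands hL)

/-- **The Fontaine–Mazur–Langlands sector statement behind the crux**: the crux with EVERY
hypothesis that Fontaine–Mazur (B) does not need DELETED — any number field `F` (not necessarily
totally real), any prime `p` (no `5 ≤ p`, no `p ∤ disc F`), no oddness, no pro-modularity, no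
Hodge–Tate regularity, and "crystalline" weakened to "de Rham" at `v ∣ p`. This is conjunct (B)
of the summit for `n = 2` with the conclusion cut down to its Satake clause. [folklore] -/
def FontaineMazurSector : Prop :=
  ∀ (F : Type) [Field F] [NumberField F] (p : ℕ) [Fact p.Prime]
    (hcpt : isCompact_glFiniteIntegralLevel 2 F) (ι : PadicAlgCl p ≃+* ℂ)
    (ρ : FramedGaloisRep F (PadicAlgCl p) 2),
    ρ.toGaloisRep.IsIrreducible → (∀ᶠ v in cofinite, ρ.IsUnramifiedAt v) →
    (∀ (v : HeightOneSpectrum (𝓞 F)) (hv : ((p : ℕ) : 𝓞 F) ∈ v.asIdeal),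
      (fontainePstAdicCompletion v p hv).IsDeRhamFramed (ρ.toLocal v)) →
    ∃ π : CuspidalAutomorphicRepData 2 F hcpt, π.1.IsLAlgebraic ∧
      ∀ᶠ v in cofinite, Summit.Langlands.SatakeFrobCompatibleAt ι π.1 ρ v

/-- `Langlands → FontaineMazurSector`. [folklore] -/
theorem fontaineMazurSector_of_langlands (hL : _root_.Langlands) : FontaineMazurSector :=
  fun _ _ _ _ _ hcpt ι ρ hirr hunr hdR => satakeConclusion_of_langlands hL two_pos hcpt ι ρ hirr hunr hdR

/-- `FontaineMazurSector → crux`: the crux is a WEAKENING of (B) in its sector. Together with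
`fontaineMazurSector_of_langlands`: `Langlands → FontaineMazurSector → crux`. [folklore] -/
theorem crux_of_fontaineMazurSector (h : FontaineMazurSector) : CrystallineProModularClassical := by
  intro F _ _ _ p _ _ _ hcpt ι ρ hirr _ hunr _ hloc
  exact h F p hcpt ι ρ hirr hunr fun v hv => (hloc v hv).1.isDeRhamFramed

/-! ## §1 Load-bearing analysis

Convention: `WithoutH` is the crux with hypothesis `H` deleted (a STRENGTHENING of the crux, so
`crux_of_withoutH` is trivial); `withoutH_of_fontaineMazurSector` shows it is still a weakening of
(B), hence predicted TRUE — so `H` is not load-bearing for truth and no `_false_without_H` theorem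
can exist short of `¬ Langlands`. The two exceptions (§1g irreducible, §1h crystalline) are NOT
weakenings of (B) and are false on paper. -/

section LoadBearing

/-! ### §1a  `hunr` is implied by pro-modularity (decoration) -/

/-- The crux with the a.e.-unramified hypothesis DROPPED. [folklore] -/
def WithoutUnramified : Prop :=
  ∀ (F : Type) [Field F] [NumberField F], IsTotallyReal F → ∀ (p : ℕ) [Fact p.Prime], 5 ≤ p →
    ¬ ((p : ℤ) ∣ discr F) → ∀ (hcpt : isCompact_glFiniteIntegralLevel 2 F) (ι : PadicAlgCl p ≃+* ℂ)
    (ρ : FramedGaloisRep F (PadicAlgCl p) 2), ρ.toGaloisRep.IsIrreducible → ρ.IsOdd →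
    (∃ 𝒰 : TameLevel 2 F p, 𝒰.IsPadicallyAutomorphic ρ) →
    (∀ (v : HeightOneSpectrum (𝓞 F)) (hv : ((p : ℕ) : 𝓞 F) ∈ v.asIdeal),
      (fontainePstAdicCompletion v p hv).IsCrystallineFramed (ρ.toLocal v) ∧
      (letI := (fontainePstAdicCompletion v p hv).algebra
       GaloisRep.IsLabelledHodgeTateRegular (fontainePstAdicCompletion v p hv).𝔅
         (ρ.toLocal v).toGaloisRep)) →
    ∃ π : CuspidalAutomorphicRepData 2 F hcpt, π.1.IsLAlgebraic ∧
      ∀ᶠ v in cofinite, Summit.Langlands.SatakeFrobCompatibleAt ι π.1 ρ v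

/-- **`hunr` is decoration**: the crux is EQUIVALENT to its version without the a.e.-unramified
hypothesis (`IsAssociated` forces unramifiedness off the finite set `𝒰.bad`; landed sibling lemma
`eventually_isUnramifiedAt_of_isPadicallyAutomorphic`). Provers may drop `hunr`. [folklore] -/
theorem crux_iff_withoutUnramified : CrystallineProModularClassical ↔ WithoutUnramified := by
  constructor
  · intro h F _ _ hF p _ hp hdisc hcpt ι ρ hirr hodd hpm hloc
    obtain ⟨𝒰, h𝒰⟩ := hpm
    exact h F hF p hp hdisc hcpt ι ρ hirr hodd
      (eventually_isUnramifiedAt_of_isPadicallyAutomorphic 𝒰 h𝒰) ⟨𝒰, h𝒰⟩ hloc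
  · intro h F _ _ hF p _ hp hdisc hcpt ι ρ hirr hodd _ hpm hloc
    exact h F hF p hp hdisc hcpt ι ρ hirr hodd hpm hloc

/-! ### §1b  Pro-modularity: the crux's only non-FM lever — NOT load-bearing for truth -/

/-- The crux with PRO-MODULARITY DROPPED: Fontaine–Mazur–Langlands (B) for `GL₂` over totally real
fields in the crystalline HT-regular sector (`p ≥ 5` unramified in `F`). OPEN; known sub-cases in
print: `F = ℚ` (Kisin, Emerton, Pan), ordinary (Skinner–Wiles, X. Zhang 2024), `p` totally split
and `F` abelian (X. Zhang 2025), residually "big image" via Taylor–Wiles–Kisin (many authors).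
A proof of the crux that never uses `hpm` proves this. [folklore] -/
def WithoutProModular : Prop :=
  ∀ (F : Type) [Field F] [NumberField F], IsTotallyReal F → ∀ (p : ℕ) [Fact p.Prime], 5 ≤ p →
    ¬ ((p : ℤ) ∣ discr F) → ∀ (hcpt : isCompact_glFiniteIntegralLevel 2 F) (ι : PadicAlgCl p ≃+* ℂ)
    (ρ : FramedGaloisRep F (PadicAlgCl p) 2), ρ.toGaloisRep.IsIrreducible → ρ.IsOdd →
    (∀ᶠ v in cofinite, ρ.IsUnramifiedAt v) →
    (∀ (v : HeightOneSpectrum (𝓞 F)) (hv : ((p : ℕ) : 𝓞 F) ∈ v.asIdeal),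
      (fontainePstAdicCompletion v p hv).IsCrystallineFramed (ρ.toLocal v) ∧
      (letI := (fontainePstAdicCompletion v p hv).algebra
       GaloisRep.IsLabelledHodgeTateRegular (fontainePstAdicCompletion v p hv).𝔅
         (ρ.toLocal v).toGaloisRep)) →
    ∃ π : CuspidalAutomorphicRepData 2 F hcpt, π.1.IsLAlgebraic ∧
      ∀ᶠ v in cofinite, Summit.Langlands.SatakeFrobCompatibleAt ι π.1 ρ v

/-- `WithoutProModular → crux` (strengthening). [folklore] -/
theorem crux_of_withoutProModular (h : WithoutProModular) : CrystallineProModularClassical := by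
  intro F _ _ hF p _ hp hdisc hcpt ι ρ hirr hodd hunr _ hloc
  exact h F hF p hp hdisc hcpt ι ρ hirr hodd hunr hloc

/-- `FontaineMazurSector → WithoutProModular`: still a corollary of the summit, so pro-modularity
is NOT load-bearing for truth (no `crux_false_without_proModular` short of `¬ Langlands`).
[folklore] -/
theorem withoutProModular_of_fontaineMazurSector (h : FontaineMazurSector) : WithoutProModular := by
  intro F _ _ _ p _ _ _ hcpt ι ρ hirr _ hunr hloc
  exact h F p hcpt ι ρ hirr hunr fun v hv => (hloc v hv).1.isDeRhamFramed

/-! ### §1c  Total oddness — NOT load-bearing for truth -/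

/-- The crux with `ρ.IsOdd` DROPPED. Predicted TRUE: (i) it is a corollary of the summit
(`withoutOdd_of_fontaineMazurSector`); (ii) independently, an irreducible pro-modular `ρ` of
`GL₂` over a totally real field is expected to be totally odd (Galois representations attached to
Hecke eigensystems in the cohomology of the Hilbert modular varieties `X_U` are totally odd, and
oddness is a closed condition on continuous points of `𝕋(K^p)`); (iii) an EVEN irreducible `ρ`
crystalline with distinct labelled weights contradicts Fontaine–Mazur + Hodge symmetry. Oddness is
kept for the METHOD (every modularity-lifting / classicality theorem a line could quote assumes
it). [folklore] -/
def WithoutOdd : Prop :=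
  ∀ (F : Type) [Field F] [NumberField F], IsTotallyReal F → ∀ (p : ℕ) [Fact p.Prime], 5 ≤ p →
    ¬ ((p : ℤ) ∣ discr F) → ∀ (hcpt : isCompact_glFiniteIntegralLevel 2 F) (ι : PadicAlgCl p ≃+* ℂ)
    (ρ : FramedGaloisRep F (PadicAlgCl p) 2), ρ.toGaloisRep.IsIrreducible →
    (∀ᶠ v in cofinite, ρ.IsUnramifiedAt v) →
    (∃ 𝒰 : TameLevel 2 F p, 𝒰.IsPadicallyAutomorphic ρ) →
    (∀ (v : HeightOneSpectrum (𝓞 F)) (hv : ((p : ℕ) : 𝓞 F) ∈ v.asIdeal),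
      (fontainePstAdicCompletion v p hv).IsCrystallineFramed (ρ.toLocal v) ∧
      (letI := (fontainePstAdicCompletion v p hv).algebra
       GaloisRep.IsLabelledHodgeTateRegular (fontainePstAdicCompletion v p hv).𝔅
         (ρ.toLocal v).toGaloisRep)) →
    ∃ π : CuspidalAutomorphicRepData 2 F hcpt, π.1.IsLAlgebraic ∧
      ∀ᶠ v in cofinite, Summit.Langlands.SatakeFrobCompatibleAt ι π.1 ρ v

/-- `WithoutOdd → crux`. [folklore] -/
theorem crux_of_withoutOdd (h : WithoutOdd) : CrystallineProModularClassical := by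
  intro F _ _ hF p _ hp hdisc hcpt ι ρ hirr _ hunr hpm hloc
  exact h F hF p hp hdisc hcpt ι ρ hirr hunr hpm hloc

/-- `FontaineMazurSector → WithoutOdd`. [folklore] -/
theorem withoutOdd_of_fontaineMazurSector (h : FontaineMazurSector) : WithoutOdd := by
  intro F _ _ _ p _ _ _ hcpt ι ρ hirr hunr _ hloc
  exact h F p hcpt ι ρ hirr hunr fun v hv => (hloc v hv).1.isDeRhamFramed

/-! ### §1d  Labelled Hodge–Tate regularity — NOT load-bearing for truth (method only) -/

/-- The crux with labelled HT-REGULARITY DROPPED (crystalline kept; irregular = partial weight one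
allowed). Predicted TRUE: a corollary of the summit (`withoutHTRegular_of_fontaineMazurSector`) —
Fontaine–Mazur–Langlands attaches to an irregular crystalline odd irreducible `ρ` a cuspidal `π`
whose archimedean components at the irregular labels are limits of discrete series (partial weight
one Hilbert forms), C-algebraic, and its L-algebraic twist `π ⊗ |det|^{1/2}` is a Borel–Jacquet
cuspidal datum (non-unitary central characters are allowed by `CuspidalAutomorphicRepData`).
Regularity is there for the METHOD: every classicality theorem for overconvergent / locally
analytic Hilbert eigenforms needs cohomological (regular) weight, cf. the catalogued
`Literature.Barriers.Langlands.NonRegularWeightBarrier` (narrowed 2026-08-15). [folklore] -/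
def WithoutHTRegular : Prop :=
  ∀ (F : Type) [Field F] [NumberField F], IsTotallyReal F → ∀ (p : ℕ) [Fact p.Prime], 5 ≤ p →
    ¬ ((p : ℤ) ∣ discr F) → ∀ (hcpt : isCompact_glFiniteIntegralLevel 2 F) (ι : PadicAlgCl p ≃+* ℂ)
    (ρ : FramedGaloisRep F (PadicAlgCl p) 2), ρ.toGaloisRep.IsIrreducible → ρ.IsOdd →
    (∀ᶠ v in cofinite, ρ.IsUnramifiedAt v) →
    (∃ 𝒰 : TameLevel 2 F p, 𝒰.IsPadicallyAutomorphic ρ) →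
    (∀ (v : HeightOneSpectrum (𝓞 F)) (hv : ((p : ℕ) : 𝓞 F) ∈ v.asIdeal),
      (fontainePstAdicCompletion v p hv).IsCrystallineFramed (ρ.toLocal v)) →
    ∃ π : CuspidalAutomorphicRepData 2 F hcpt, π.1.IsLAlgebraic ∧
      ∀ᶠ v in cofinite, Summit.Langlands.SatakeFrobCompatibleAt ι π.1 ρ v

/-- `WithoutHTRegular → crux`. [folklore] -/
theorem crux_of_withoutHTRegular (h : WithoutHTRegular) : CrystallineProModularClassical := by
  intro F _ _ hF p _ hp hdisc hcpt ι ρ hirr hodd hunr hpm hloc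
  exact h F hF p hp hdisc hcpt ι ρ hirr hodd hunr hpm fun v hv => (hloc v hv).1

/-- `FontaineMazurSector → WithoutHTRegular`. [folklore] -/
theorem withoutHTRegular_of_fontaineMazurSector (h : FontaineMazurSector) : WithoutHTRegular := by
  intro F _ _ _ p _ _ _ hcpt ι ρ hirr _ hunr _ hloc
  exact h F p hcpt ι ρ hirr hunr fun v hv => (hloc v hv).isDeRhamFramed

/-! ### §1d'  Regularity AS TYPED is vacuous off the Hodge–Tate locus

`IsLabelledHodgeTateRegular 𝔅 ρ := ∀ τ, (HT_τ ρ).Nodup` with `HT_τ = jumpMultiset (dim_E Fil^• D_τ)`.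
A representation with NO periods (`D_τ = 0`, or any filtration without jumps) has `HT_τ = ∅`,
which is `Nodup`: it is "regular" as typed. So in `hloc` the regularity conjunct constrains only
representations that already have de Rham periods; the crystalline conjunct carries the content. -/

/-- A jump multiset is multiplicity-free as soon as every jump has height `≤ 1` (and, by the junk
value `0`, whenever the set of jumps is infinite). [folklore] -/
theorem nodup_jumpMultiset_of_forall_sub_le_one {d : ℤ → ℕ} (h : ∀ i, d i - d (i + 1) ≤ 1) :
    (jumpMultiset d).Nodup := by
  by_cases hf : {i : ℤ | d (i + 1) < d i}.Finite
  · rw [Multiset.nodup_iff_count_le_one]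
    intro i
    rw [count_jumpMultiset hf]
    exact h i
  · rw [jumpMultiset_of_not_finite hf]
    exact Multiset.nodup_zero

/-- Conversely, with finitely many jumps, multiplicity-free means every jump has height `≤ 1`:
for the genuine `D_dR` of a de Rham rank-`n` representation this is "all `gr^i D_τ` have
dimension `≤ 1`", i.e. `n` distinct `τ`-weights — the intended meaning. [folklore] -/
theorem sub_le_one_of_nodup_jumpMultiset {d : ℤ → ℕ} (hf : {i : ℤ | d (i + 1) < d i}.Finite)
    (h : (jumpMultiset d).Nodup) (i : ℤ) : d i - d (i + 1) ≤ 1 := by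
  rw [← count_jumpMultiset hf]
  exact Multiset.nodup_iff_count_le_one.1 h i

/-- A function without jumps has EMPTY jump multiset. [folklore] -/
theorem jumpMultiset_eq_zero_of_forall_eq {d : ℤ → ℕ} (h : ∀ i, d (i + 1) = d i) :
    jumpMultiset d = 0 := by
  have hf : {i : ℤ | d (i + 1) < d i} = ∅ := Set.eq_empty_of_forall_notMem fun i hi => by
    simp only [Set.mem_setOf_eq, h i, lt_self_iff_false] at hi
  rw [jumpMultiset_of_finite (by rw [hf]; exact Set.finite_empty)]
  refine Finset.sum_eq_zero fun i _ => ?_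
  rw [h i, Nat.sub_self, Multiset.replicate_zero]

section PeriodRing

variable {Γ : Type u} [Group Γ] [TopologicalSpace Γ] {P : Type v} {K : Type v'} [Field P]
  [Field K] [Algebra P K]
  {E : Type*} [Field E] [Algebra P E] [TopologicalSpace E]
  {M : Type*} [AddCommGroup M] [Module E M] [Module P M] [IsScalarTower P E M]
  [TopologicalSpace M]
  (𝔅 : PeriodRingData.{u, v, v', w} Γ P K) (r : ContinuousRep Γ E M)

/-- **"Labelled-HT-regular" as typed is VACUOUS off the Hodge–Tate locus.** If for every label `τ`
the filtration of `D_τ` has no jumps (e.g. `D_τ = 0`), then every `HT_τ(r)` is EMPTY, hence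
`Nodup`, and `r` is `IsLabelledHodgeTateRegular` although it has no Hodge–Tate weights at all.
[folklore] -/
theorem isLabelledHodgeTateRegular_of_forall_finrank_succ_eq
    (h : ∀ (τ : K →ₐ[P] E) (i : ℤ), Module.finrank E (𝔅.labelFilD r τ.toRingHom (i + 1)) =
      Module.finrank E (𝔅.labelFilD r τ.toRingHom i)) :
    𝔅.IsLabelledHodgeTateRegular r := fun τ => by
  rw [PeriodRingData.labelledHodgeTateWeights_def, jumpMultiset_eq_zero_of_forall_eq (h τ)]
  exact Multiset.nodup_zero

/-- In that situation every labelled weight multiset is empty. [folklore] -/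
theorem labelledHodgeTateWeights_eq_zero_of_forall_finrank_succ_eq (τ : K →+* E)
    (h : ∀ i : ℤ, Module.finrank E (𝔅.labelFilD r τ (i + 1)) =
      Module.finrank E (𝔅.labelFilD r τ i)) :
    𝔅.labelledHodgeTateWeights r τ = 0 := by
  rw [PeriodRingData.labelledHodgeTateWeights_def, jumpMultiset_eq_zero_of_forall_eq h]

/-- **No periods ⇒ "regular".** If `D(r) = (M ⊗ B)^Γ = 0` (no invariant tensor: the extreme
non-de-Rham case, e.g. an irreducible `ρ ⊗ ⟨ε⟩^t`, `2t ∉ ℤ`), then `r` is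
labelled-Hodge–Tate-regular as typed. [folklore] -/
theorem isLabelledHodgeTateRegular_of_coeffD_eq_bot (h : 𝔅.coeffD r = ⊥) :
    𝔅.IsLabelledHodgeTateRegular r := by
  refine isLabelledHodgeTateRegular_of_forall_finrank_succ_eq 𝔅 r fun τ i => ?_
  have hD : ∀ j, 𝔅.labelFilD r τ.toRingHom j = ⊥ := fun j =>
    eq_bot_iff.2 (((𝔅.labelFilD_le r _ j).trans (𝔅.labelD_le_coeffD r _)).trans h.le)
  rw [hD, hD]

end PeriodRing

/-- **At the crux's types**: a `ρ : Γ_F → GL₂(ℚ̄_p)` whose local restriction at `v ∣ p` has NO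
`B_dR`-periods for the pinned datum (`D = 0`) satisfies the crux's regularity conjunct at `v`.
So the regularity conjunct of `hloc` never excludes a non-Hodge–Tate witness; only the
crystalline conjunct does (§1h). [folklore] -/
theorem hreg_of_coeffD_eq_bot {F : Type} [Field F] [NumberField F] {p : ℕ} [Fact p.Prime]
    (ρ : FramedGaloisRep F (PadicAlgCl p) 2) (v : HeightOneSpectrum (𝓞 F))
    (hv : ((p : ℕ) : 𝓞 F) ∈ v.asIdeal)
    (h : letI := (fontainePstAdicCompletion v p hv).algebra
      (fontainePstAdicCompletion v p hv).𝔅.coeffD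
        ((ρ.toLocal v).toGaloisRep : ContinuousRep _ (PadicAlgCl p) (Fin 2 → PadicAlgCl p)) = ⊥) :
    letI := (fontainePstAdicCompletion v p hv).algebra
    GaloisRep.IsLabelledHodgeTateRegular (fontainePstAdicCompletion v p hv).𝔅
      (ρ.toLocal v).toGaloisRep := by
  letI := (fontainePstAdicCompletion v p hv).algebra
  exact isLabelledHodgeTateRegular_of_coeffD_eq_bot _ _ h

/-! ### §1e  `5 ≤ p`, `p ∤ disc F`, `F` totally real — NOT load-bearing for truth (method only) -/

/-- The crux with the BASE CONDITIONS DROPPED: any number field `F`, any prime `p`. Predicted TRUE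
(a corollary of the summit, `withoutBaseConditions_of_fontaineMazurSector`). The conditions serve
the METHOD: `p` unramified in `F` is the standing hypothesis of the mod-`p`/locally-analytic
representation theory of `GL₂(F_v)` the route imports (BHHMS genericity, Breuil–Ding), `p ≥ 5`
avoids `ζ_p ∈ F`-type and small-prime pathologies, and total reality is what makes `X_U` a
Hilbert modular variety (Shimura) so that overconvergent/coherent classicality exists at all.
[folklore] -/
def WithoutBaseConditions : Prop :=
  ∀ (F : Type) [Field F] [NumberField F] (p : ℕ) [Fact p.Prime]
    (hcpt : isCompact_glFiniteIntegralLevel 2 F) (ι : PadicAlgCl p ≃+* ℂ)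
    (ρ : FramedGaloisRep F (PadicAlgCl p) 2), ρ.toGaloisRep.IsIrreducible → ρ.IsOdd →
    (∀ᶠ v in cofinite, ρ.IsUnramifiedAt v) →
    (∃ 𝒰 : TameLevel 2 F p, 𝒰.IsPadicallyAutomorphic ρ) →
    (∀ (v : HeightOneSpectrum (𝓞 F)) (hv : ((p : ℕ) : 𝓞 F) ∈ v.asIdeal),
      (fontainePstAdicCompletion v p hv).IsCrystallineFramed (ρ.toLocal v) ∧
      (letI := (fontainePstAdicCompletion v p hv).algebra
       GaloisRep.IsLabelledHodgeTateRegular (fontainePstAdicCompletion v p hv).𝔅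
         (ρ.toLocal v).toGaloisRep)) →
    ∃ π : CuspidalAutomorphicRepData 2 F hcpt, π.1.IsLAlgebraic ∧
      ∀ᶠ v in cofinite, Summit.Langlands.SatakeFrobCompatibleAt ι π.1 ρ v

/-- `WithoutBaseConditions → crux`. [folklore] -/
theorem crux_of_withoutBaseConditions (h : WithoutBaseConditions) :
    CrystallineProModularClassical := by
  intro F _ _ _ p _ _ _ hcpt ι ρ hirr hodd hunr hpm hloc
  exact h F p hcpt ι ρ hirr hodd hunr hpm hloc

/-- `FontaineMazurSector → WithoutBaseConditions`. [folklore] -/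
theorem withoutBaseConditions_of_fontaineMazurSector (h : FontaineMazurSector) :
    WithoutBaseConditions := by
  intro F _ _ p _ hcpt ι ρ hirr _ hunr _ hloc
  exact h F p hcpt ι ρ hirr hunr fun v hv => (hloc v hv).1.isDeRhamFramed

/-! ### §1f  Crystalline ⇝ de Rham — the weakening is still predicted -/

/-- The crux with "crystalline" WEAKENED to "de Rham" (potentially semistable: `N ≠ 0` and
potentially-crystalline local behaviour allowed at `v ∣ p`; regularity kept). Predicted TRUE (a
corollary of the summit). For the METHOD the difference is real: semistable non-crystalline `ρ_v`
(Steinberg at `p`) and potentially crystalline `ρ_v` (supercuspidal/ramified principal series at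
`p`) need level at `p` in the eigenvariety and different companion-form bookkeeping. [folklore] -/
def WithDeRham : Prop :=
  ∀ (F : Type) [Field F] [NumberField F], IsTotallyReal F → ∀ (p : ℕ) [Fact p.Prime], 5 ≤ p →
    ¬ ((p : ℤ) ∣ discr F) → ∀ (hcpt : isCompact_glFiniteIntegralLevel 2 F) (ι : PadicAlgCl p ≃+* ℂ)
    (ρ : FramedGaloisRep F (PadicAlgCl p) 2), ρ.toGaloisRep.IsIrreducible → ρ.IsOdd →
    (∀ᶠ v in cofinite, ρ.IsUnramifiedAt v) →
    (∃ 𝒰 : TameLevel 2 F p, 𝒰.IsPadicallyAutomorphic ρ) →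
    (∀ (v : HeightOneSpectrum (𝓞 F)) (hv : ((p : ℕ) : 𝓞 F) ∈ v.asIdeal),
      (fontainePstAdicCompletion v p hv).IsDeRhamFramed (ρ.toLocal v) ∧
      (letI := (fontainePstAdicCompletion v p hv).algebra
       GaloisRep.IsLabelledHodgeTateRegular (fontainePstAdicCompletion v p hv).𝔅
         (ρ.toLocal v).toGaloisRep)) →
    ∃ π : CuspidalAutomorphicRepData 2 F hcpt, π.1.IsLAlgebraic ∧
      ∀ᶠ v in cofinite, Summit.Langlands.SatakeFrobCompatibleAt ι π.1 ρ v

/-- `WithDeRham → crux`. [folklore] -/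
theorem crux_of_withDeRham (h : WithDeRham) : CrystallineProModularClassical := by
  intro F _ _ hF p _ hp hdisc hcpt ι ρ hirr hodd hunr hpm hloc
  exact h F hF p hp hdisc hcpt ι ρ hirr hodd hunr hpm
    fun v hv => ⟨(hloc v hv).1.isDeRhamFramed, (hloc v hv).2⟩

/-- `FontaineMazurSector → WithDeRham`. [folklore] -/
theorem withDeRham_of_fontaineMazurSector (h : FontaineMazurSector) : WithDeRham := by
  intro F _ _ _ p _ _ _ hcpt ι ρ hirr _ hunr _ hloc
  exact h F p hcpt ι ρ hirr hunr fun v hv => (hloc v hv).1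

/-! ### §1g  Irreducibility — LOAD-BEARING for truth (paper witness; formal half below) -/

/-- The crux with IRREDUCIBILITY DROPPED. FALSE ON PAPER, not a corollary of the summit ((B) asks
for irreducible `ρ`): the degree-`0` Eisenstein eigensystem of the constructed tower — `T_{v,1} ↦
q_v + 1`, `T_{v,2} ↦ 1` on the constants of `H⁰(X_{U_r}, ℤ/p^s)`, all `r, s` — is a continuous
`ℤ_p`-point of `𝕋(𝒰)` (full level) associated with `ρ = 1 ⊕ ε` (`heckeFrobPoly 2 q (q+1, 1) =
(X − 1)(X − q)`, arithmetic Frobenius, `heckeFrobPoly_two_eisenstein`); `1 ⊕ ε` is totally odd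
(`ε(c) = −1`), unramified away from `p`, crystalline at `v ∣ p` with labelled weights `{0, −1}`
(pairwise distinct), and NO cuspidal `π` on `GL₂(𝔸_F)` has Satake parameters of `1 ⊞ |·|^{-1}`-type
at almost all `v` (Jacquet–Shalika). A Lean witness needs (i) the Hecke action on `H⁰` of the
constructed tower unfolded (`groupCohomology` in degree `0` + the double-coset decomposition of
`GL₂(𝒪_v) diag(ϖ,1) GL₂(𝒪_v)`), (ii) crystallinity of `1 ⊕ ε` for the `ε`-pinned datum (its
Weil–Deligne half is pinned by specification: provable only through the clauses (F3), (F4), (F8),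
(F11) of `IsFontaineDatum` under `FontaineDatumExists`, none of which covers a direct sum), and
(iii) Jacquet–Shalika — all absent. [folklore] -/
def WithoutIrreducible : Prop :=
  ∀ (F : Type) [Field F] [NumberField F], IsTotallyReal F → ∀ (p : ℕ) [Fact p.Prime], 5 ≤ p →
    ¬ ((p : ℤ) ∣ discr F) → ∀ (hcpt : isCompact_glFiniteIntegralLevel 2 F) (ι : PadicAlgCl p ≃+* ℂ)
    (ρ : FramedGaloisRep F (PadicAlgCl p) 2), ρ.IsOdd →
    (∀ᶠ v in cofinite, ρ.IsUnramifiedAt v) →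
    (∃ 𝒰 : TameLevel 2 F p, 𝒰.IsPadicallyAutomorphic ρ) →
    (∀ (v : HeightOneSpectrum (𝓞 F)) (hv : ((p : ℕ) : 𝓞 F) ∈ v.asIdeal),
      (fontainePstAdicCompletion v p hv).IsCrystallineFramed (ρ.toLocal v) ∧
      (letI := (fontainePstAdicCompletion v p hv).algebra
       GaloisRep.IsLabelledHodgeTateRegular (fontainePstAdicCompletion v p hv).𝔅
         (ρ.toLocal v).toGaloisRep)) →
    ∃ π : CuspidalAutomorphicRepData 2 F hcpt, π.1.IsLAlgebraic ∧
      ∀ᶠ v in cofinite, Summit.Langlands.SatakeFrobCompatibleAt ι π.1 ρ v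

/-- `WithoutIrreducible → crux` (a genuine strengthening). [folklore] -/
theorem crux_of_withoutIrreducible (h : WithoutIrreducible) : CrystallineProModularClassical := by
  intro F _ _ hF p _ hp hdisc hcpt ι ρ _ hodd hunr hpm hloc
  exact h F hF p hp hdisc hcpt ι ρ hodd hunr hpm hloc

/-- **Formal half of §1g: Borel-framed `ρ` are excluded by H1.** A `ρ : Γ_F → GL₂(ℚ̄_p)` upper
triangular in ONE global frame `Q` — every `χ₁ ⊕ χ₂`, `1 ⊕ ε`, every extension `(χ₁ ∗; 0 χ₂)`,
i.e. every representation an Eisenstein point of `𝕋(𝒰)` can be associated with — violates the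
crux's irreducibility hypothesis (sibling lemma `not_isIrreducible_of_conj_upperTriangular`,
landed). [folklore] -/
theorem not_isIrreducible_of_borelFrame {F : Type} [Field F] [NumberField F] {p : ℕ} [Fact p.Prime]
    (ρ : FramedGaloisRep F (PadicAlgCl p) 2) (Q : GL (Fin 2) (PadicAlgCl p))
    (h : ∀ σ, (Q⁻¹ * ρ σ * Q).val 1 0 = 0) : ¬ ρ.toGaloisRep.IsIrreducible :=
  not_isIrreducible_of_conj_upperTriangular ρ Q h

/-- **The Eisenstein Hecke–Frobenius polynomial** (landed sibling lemma): at the degree-`0`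
eigensystem `(q+1, 1)` the polynomial of `IsAssociated` is `(X − 1)(X − q)`, the ARITHMETIC
Frobenius polynomial of `1 ⊕ ε`. Normalisation check behind §1g. [folklore] -/
example {R : Type*} [CommRing R] (q : ℕ) (a : ℕ → R) (h1 : a 1 = q + 1) (h2 : a 2 = 1) :
    heckeFrobPoly 2 q a = (X - 1) * (X - C (q : R)) :=
  heckeFrobPoly_two_eisenstein q a h1 h2

/-! ### §1h  Crystallinity at `v ∣ p` — LOAD-BEARING for truth (paper witness inside `F = ℚ`) -/

/-- The crux with the CRYSTALLINE conjunct DROPPED (regularity-as-typed kept). FALSE ON PAPER, with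
a witness inside the crux's own range `F = ℚ`, `p ≥ 5`: let `f` be a classical newform of weight
`k ≥ 2` and level prime to `p`, `ρ_f` its `p`-adic representation, `⟨ε⟩ : Γ_ℚ → 1 + pℤ_p` the
projection of the cyclotomic character to the principal units and `t ∈ ℤ_p` with `2t ∉ ℤ`. Then
`ρ_t := ρ_f ⊗ ⟨ε⟩^t` is irreducible, totally odd (`⟨ε⟩(c) = 1`), unramified outside `Np`,
PRO-MODULAR of the same tame level (cup product with the locally constant function
`⟨ε⟩^t ∘ det` on `X_{U_r}`, `r ≫ s`, conjugates `T_ℓ` into `⟨ℓ⟩^t T_ℓ` on `H^•(X_{U_r}, ℤ/p^s)`,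
so the twisted eigensystem is a continuous point of `𝕋(K^p)`), NOT de Rham at `p` (its Sen
weights `t, t + k − 1` are not integers), and "labelled-HT-regular" AS TYPED vacuously
(`D_dR(ρ_t|_{G_{ℚ_p}}) = 0`, §1d' `hreg_of_coeffD_eq_bot`). If an L-algebraic cuspidal `π` matched
`ρ_t` at almost all primes, the determinant shadow (`exists_heckeCharacter_of_satakeConclusion`,
landed) would make `ι ∘ det ρ_t = ι ∘ (det ρ_f · ⟨ε⟩^{2t})` the Satake shadow of the central
character `ω_π`, an algebraic Hecke character (type `A₀`) for L-algebraic `π`; by Chebotarev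
`det ρ_t` would be locally algebraic at `p`, i.e. `2t ∈ ℤ` — contradiction. So `WithoutCrystalline`
fails for EVERY `ι`. Not Lean-constructible today (needs `ρ_f` and its pro-modularity). [folklore] -/
def WithoutCrystalline : Prop :=
  ∀ (F : Type) [Field F] [NumberField F], IsTotallyReal F → ∀ (p : ℕ) [Fact p.Prime], 5 ≤ p →
    ¬ ((p : ℤ) ∣ discr F) → ∀ (hcpt : isCompact_glFiniteIntegralLevel 2 F) (ι : PadicAlgCl p ≃+* ℂ)
    (ρ : FramedGaloisRep F (PadicAlgCl p) 2), ρ.toGaloisRep.IsIrreducible → ρ.IsOdd →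
    (∀ᶠ v in cofinite, ρ.IsUnramifiedAt v) →
    (∃ 𝒰 : TameLevel 2 F p, 𝒰.IsPadicallyAutomorphic ρ) →
    (∀ (v : HeightOneSpectrum (𝓞 F)) (hv : ((p : ℕ) : 𝓞 F) ∈ v.asIdeal),
      (letI := (fontainePstAdicCompletion v p hv).algebra
       GaloisRep.IsLabelledHodgeTateRegular (fontainePstAdicCompletion v p hv).𝔅
         (ρ.toLocal v).toGaloisRep)) →
    ∃ π : CuspidalAutomorphicRepData 2 F hcpt, π.1.IsLAlgebraic ∧
      ∀ᶠ v in cofinite, Summit.Langlands.SatakeFrobCompatibleAt ι π.1 ρ v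

/-- `WithoutCrystalline → crux` (a genuine strengthening; its paper witness above shows the
crystalline conjunct of `hloc` cannot be dropped). [folklore] -/
theorem crux_of_withoutCrystalline (h : WithoutCrystalline) : CrystallineProModularClassical := by
  intro F _ _ hF p _ hp hdisc hcpt ι ρ hirr hodd hunr hpm hloc
  exact h F hF p hp hdisc hcpt ι ρ hirr hodd hunr hpm fun v hv => (hloc v hv).2

end LoadBearing

/-! ## §2 Natural strengthenings -/

section Strengthenings

/-- The crux with Satake–Frobenius matching demanded at EVERY finite place (not just cofinitely
many). FALSE as soon as some `ρ` of the sector is ramified at one place (`SatakeFrobCompatibleAt`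
contains `ρ.IsUnramifiedAt v`); e.g. `ρ_f` for a newform of level `N > 1` prime to `p`, which is in
the sector (classical, hence pro-modular and crystalline regular) and ramified at `ℓ ∣ N`. The
formal half is `withAllPlaces_false_of_witness`; the witness itself is not Lean-constructible.
Recorded so that no skeleton over-states the exit's output. [folklore] -/
def WithAllPlaces : Prop :=
  ∀ (F : Type) [Field F] [NumberField F], IsTotallyReal F → ∀ (p : ℕ) [Fact p.Prime], 5 ≤ p →
    ¬ ((p : ℤ) ∣ discr F) → ∀ (hcpt : isCompact_glFiniteIntegralLevel 2 F) (ι : PadicAlgCl p ≃+* ℂ)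
    (ρ : FramedGaloisRep F (PadicAlgCl p) 2), ρ.toGaloisRep.IsIrreducible → ρ.IsOdd →
    (∀ᶠ v in cofinite, ρ.IsUnramifiedAt v) →
    (∃ 𝒰 : TameLevel 2 F p, 𝒰.IsPadicallyAutomorphic ρ) →
    (∀ (v : HeightOneSpectrum (𝓞 F)) (hv : ((p : ℕ) : 𝓞 F) ∈ v.asIdeal),
      (fontainePstAdicCompletion v p hv).IsCrystallineFramed (ρ.toLocal v) ∧
      (letI := (fontainePstAdicCompletion v p hv).algebra
       GaloisRep.IsLabelledHodgeTateRegular (fontainePstAdicCompletion v p hv).𝔅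
         (ρ.toLocal v).toGaloisRep)) →
    ∃ π : CuspidalAutomorphicRepData 2 F hcpt, π.1.IsLAlgebraic ∧
      ∀ v, Summit.Langlands.SatakeFrobCompatibleAt ι π.1 ρ v

/-- `WithAllPlaces → crux`. [folklore] -/
theorem crux_of_withAllPlaces (h : WithAllPlaces) : CrystallineProModularClassical := by
  intro F _ _ hF p _ hp hdisc hcpt ι ρ hirr hodd hunr hpm hloc
  obtain ⟨π, hL, hv⟩ := h F hF p hp hdisc hcpt ι ρ hirr hodd hunr hpm hloc
  exact ⟨π, hL, Filter.Eventually.of_forall hv⟩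

/-- **Formal half of §2**: Satake matching at `v` forces `ρ` unramified at `v`, so ONE `ρ` of the
sector ramified at ONE place refutes `WithAllPlaces`. [folklore] -/
theorem withAllPlaces_false_of_witness
    (hw : ∃ (F : Type) (_ : Field F) (_ : NumberField F) (_ : IsTotallyReal F) (p : ℕ)
      (_ : Fact p.Prime) (_ : 5 ≤ p) (_ : ¬ ((p : ℤ) ∣ discr F))
      (_ : isCompact_glFiniteIntegralLevel 2 F) (_ : PadicAlgCl p ≃+* ℂ)
      (ρ : FramedGaloisRep F (PadicAlgCl p) 2), ρ.toGaloisRep.IsIrreducible ∧ ρ.IsOdd ∧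
      (∀ᶠ v in cofinite, ρ.IsUnramifiedAt v) ∧
      (∃ 𝒰 : TameLevel 2 F p, 𝒰.IsPadicallyAutomorphic ρ) ∧
      (∀ (v : HeightOneSpectrum (𝓞 F)) (hv : ((p : ℕ) : 𝓞 F) ∈ v.asIdeal),
        (fontainePstAdicCompletion v p hv).IsCrystallineFramed (ρ.toLocal v) ∧
        (letI := (fontainePstAdicCompletion v p hv).algebra
         GaloisRep.IsLabelledHodgeTateRegular (fontainePstAdicCompletion v p hv).𝔅
           (ρ.toLocal v).toGaloisRep)) ∧
      ∃ v, ¬ ρ.IsUnramifiedAt v) :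
    ¬ WithAllPlaces := by
  rintro h
  obtain ⟨F, _, _, hF, p, _, hp, hdisc, hcpt, ι, ρ, hirr, hodd, hunr, hpm, hloc, v, hv⟩ := hw
  obtain ⟨π, -, hall⟩ := h F hF p hp hdisc hcpt ι ρ hirr hodd hunr hpm hloc
  obtain ⟨α, -, hur, -⟩ := hall v
  exact hv hur

end Strengthenings

/-! ## §3 Non-vacuity of every binder; the `F = ℚ` slice -/

section NonVacuity

/-- **The base conditions are met by `F = ℚ` and every prime `p ≥ 5`**: `ℚ` is totally real and
`disc ℚ = 1` (Mathlib `NumberField.discr_rat`), so `p ∤ disc ℚ`. In particular the crux is not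
vacuous in `(F, p)` and CONTAINS the `GL₂/ℚ` statement `CruxOverQ` below. [folklore] -/
theorem baseConditions_rat (p : ℕ) [hp : Fact p.Prime] :
    IsTotallyReal ℚ ∧ ¬ ((p : ℤ) ∣ discr ℚ) := by
  refine ⟨inferInstance, fun h => ?_⟩
  rw [discr_rat] at h
  exact hp.out.ne_one (by exact_mod_cast Int.eq_one_of_dvd_one (Int.natCast_nonneg p) h)

/-- **`ι` exists** (Steinitz; tree lemma `PadicAlgCl.nonempty_ringEquiv_complex`). [folklore] -/
theorem iota_nonempty (p : ℕ) [Fact p.Prime] : Nonempty (PadicAlgCl p ≃+* ℂ) :=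
  PadicAlgCl.nonempty_ringEquiv_complex p

/-- **`hcpt` holds** (`isCompact_glFiniteIntegralLevel_holds`), so the binder typing the conclusion
is inhabited and proof-irrelevant. [folklore] -/
theorem hcpt_holds (F : Type) [Field F] [NumberField F] : isCompact_glFiniteIntegralLevel 2 F :=
  isCompact_glFiniteIntegralLevel_holds 2 F

/-- **Tame levels exist** (`TameLevel.full`: `GL₂(𝒪̂_F)`, `S = {v ∣ p}`). [folklore] -/
theorem tameLevel_nonempty (F : Type) [Field F] [NumberField F] (p : ℕ) [Fact p.Prime] :
    Nonempty (TameLevel 2 F p) :=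
  ⟨TameLevel.full 2 F p⟩

/-- **The `F = ℚ` slice of the crux**: for `p ≥ 5`, every irreducible odd a.e.-unramified
pro-modular `ρ : Γ_ℚ → GL₂(ℚ̄_p)`, crystalline at `p` with distinct Hodge–Tate weights, is
classical. IN PRINT: Emerton, *Local-global compatibility in the p-adic Langlands programme for
GL₂/ℚ* (2011) Thm. 1.2.4 (under mild hypotheses on `ρ̄|_{G_{ℚ_p}}`), and unconditionally in `ρ̄`
Pan, *On locally analytic vectors of the completed cohomology of modular curves II*, Ann. of
Math. 203 (2026) (pro-modular + de Rham of regular weight ⇒ classical, by geometric Sen theory,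
without `p`-adic local Langlands). So the `d = 1` case carries no risk; the crux's open content is
`[F:ℚ] ≥ 2` (Jiang, arXiv:2605.18426 Thm. 1.1.1: PARALLEL regular weight, any `F`, `p`, under
`H̃^d(K^p)[χ] ≠ 0`; non-parallel weight open). [folklore] -/
def CruxOverQ : Prop :=
  ∀ (p : ℕ) [Fact p.Prime], 5 ≤ p → ∀ (hcpt : isCompact_glFiniteIntegralLevel 2 ℚ)
    (ι : PadicAlgCl p ≃+* ℂ) (ρ : FramedGaloisRep ℚ (PadicAlgCl p) 2),
    ρ.toGaloisRep.IsIrreducible → ρ.IsOdd → (∀ᶠ v in cofinite, ρ.IsUnramifiedAt v) →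
    (∃ 𝒰 : TameLevel 2 ℚ p, 𝒰.IsPadicallyAutomorphic ρ) →
    (∀ (v : HeightOneSpectrum (𝓞 ℚ)) (hv : ((p : ℕ) : 𝓞 ℚ) ∈ v.asIdeal),
      (fontainePstAdicCompletion v p hv).IsCrystallineFramed (ρ.toLocal v) ∧
      (letI := (fontainePstAdicCompletion v p hv).algebra
       GaloisRep.IsLabelledHodgeTateRegular (fontainePstAdicCompletion v p hv).𝔅
         (ρ.toLocal v).toGaloisRep)) →
    ∃ π : CuspidalAutomorphicRepData 2 ℚ hcpt, π.1.IsLAlgebraic ∧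
      ∀ᶠ v in cofinite, Summit.Langlands.SatakeFrobCompatibleAt ι π.1 ρ v

/-- The crux contains its `F = ℚ` slice. [folklore] -/
theorem cruxOverQ_of_crux (h : CrystallineProModularClassical) : CruxOverQ := by
  intro p _ hp hcpt ι ρ hirr hodd hunr hpm hloc
  exact h ℚ (baseConditions_rat p).1 p hp (baseConditions_rat p).2 hcpt ι ρ hirr hodd hunr hpm hloc

end NonVacuity

/-! ## §4 Structure of would-be witnesses (imports from the sibling crux, general `F`) -/

section Structure

variable {F : Type} [Field F] [NumberField F] {p : ℕ} [Fact p.Prime]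

/-- **H4 (pro-modularity) yields an INTEGRAL continuous eigensystem** (landed,
`Negative.hpm_point_integral`): `‖x t‖ ≤ 1` for every `t ∈ 𝕋(𝒰)`. A would-be counterexample cannot
use a non-integral junk point of the big Hecke algebra. [folklore] -/
example {ρ : FramedGaloisRep F (PadicAlgCl p) 2}
    (hpm : ∃ 𝒰 : TameLevel 2 F p, 𝒰.IsPadicallyAutomorphic ρ) :
    ∃ (𝒰 : TameLevel 2 F p) (x : CompletedCohomologyHeckeAlgebraGLn 𝒰 →+* PadicAlgCl p),
      Continuous x ∧ 𝒰.IsAssociated x ρ ∧ ∀ t, ‖x t‖ ≤ 1 :=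
  hpm_point_integral hpm

/-- **Frobenius traces/determinants of a pro-modular `ρ` are integral at good places** (landed,
`Negative.norm_trace_det_frob_le_one`). [folklore] -/
example {𝒰 : TameLevel 2 F p} {ρ : FramedGaloisRep F (PadicAlgCl p) 2}
    (h : 𝒰.IsPadicallyAutomorphic ρ) {v : HeightOneSpectrum (𝓞 F)} (hv : v ∉ 𝒰.bad)
    {𝔓 : Ideal (absIntegers (𝓞 F) F)} (h𝔓 : 𝔓 ∈ v.primesAbove) {σ : Field.absoluteGaloisGroup F}
    (hσ : IsArithFrobAt (𝓞 F) σ 𝔓) :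
    ‖(ρ σ).val.trace‖ ≤ 1 ∧ ‖(ρ σ).val.det‖ ≤ 1 :=
  norm_trace_det_frob_le_one h hv h𝔓 hσ

/-- **Determinant shadow of the conclusion** (landed, `Negative.exists_heckeCharacter_of_satakeConclusion`):
if the crux's conclusion holds for `(ι, ρ)` then `ι ∘ (det ρ)⁻¹` on Frobenii is, at almost all
places, the value at a uniformiser of a (continuous, `F^×`-invariant) Hecke character — the door
through which the paper witnesses of §1h are killed. [folklore] -/
example {hcpt : isCompact_glFiniteIntegralLevel 2 F} (ι : PadicAlgCl p ≃+* ℂ)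
    (ρ : FramedGaloisRep F (PadicAlgCl p) 2)
    (h : ∃ π : CuspidalAutomorphicRepData 2 F hcpt, π.1.IsLAlgebraic ∧
      ∀ᶠ v in cofinite, Summit.Langlands.SatakeFrobCompatibleAt ι π.1 ρ v) :
    ∃ Ω : HeckeCharacter F, ∀ᶠ v : HeightOneSpectrum (𝓞 F) in cofinite,
      Ω.IsUnramifiedAt v ∧
        ∀ 𝔓 ∈ v.primesAbove, ∀ σ : Field.absoluteGaloisGroup F, IsArithFrobAt (𝓞 F) σ 𝔓 →
          (Ω.valueAtUniformizer v : ℂ) * ι (ρ σ).val.det = 1 :=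
  exists_heckeCharacter_of_satakeConclusion ι ρ (h.imp fun _ hπ => hπ.2)

end Structure

/-! ## §5 Attack log (gen 1, cycle 1, 2026-08-17) and WHY IT RESISTS

Attacks run, cheapest first, all against the crux AS TYPED:
1. ELABORATION: `theorem probe : CrystallineProModularClassical := by sorry` — rc 0, axioms
   {propext, Classical.choice, Quot.sound}. Read-back: binders in the printed order; `n = 2`
   fixed; `5 ≤ p`, `p` prime, `¬ (p : ℤ) ∣ discr F` (Mathlib `NumberField.discr`); `hcpt`, `ι`
   data of the conclusion's types; `hloc` a conjunction per `v ∣ p` with the SAME term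
   `fontainePstAdicCompletion v p hv` in both conjuncts and `letI := ….algebra` supplying the
   `ℚ_p`-structure of `F_v` to the labels `τ : F_v →ₐ[ℚ_p] ℚ̄_p`; no `/`, no ℕ-subtraction, no
   `Finset.sup`, no `tsum`.
2. INTERFACE AUDIT one level down (files `FontaineDpst`, `FontaineDpstUnconditional`,
   `CrystallineDeformationRing` §Pst, `LabelledHodgeTateWeights`, `PstWeilDeligne`, `GaloisRep`
   (`IsOdd`, `IsComplexConjugation`), `CompletedCohomologyHeckeAlgebraGLn`, summit `Statement`):
   * `fontainePstAdicCompletion` = Hilbert-`ε` over data ON THE CONSTRUCTED `B_dR(F_v)`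
     (`fontainePstAdicCompletion_𝔅_eq_bdRPeriodRingData`, unconditional) selected by
     `IsFontaineDatum` (F1)–(F11); the Weil–Deligne half `IsWeilDeligneOf` is pinned by
     specification. CONSEQUENCE FOR ANY WITNESS: `IsCrystallineFramed` is provable for a given
     `ρ_v` only from the structure axioms + clauses — today: locally unramified `ρ_v`
     (`isCrystallineFramed_of_isLocallyUnramified`, unconditional), the cyclotomic character (F4,
     under `FontaineDatumExists`); de Rham-ness also for Tate twists and finite image. No
     IRREDUCIBLE rank-2 `ρ` with DISTINCT labelled weights can presently be certified
     crystalline: the Artin-type (unramified at `p`) irreducibles are certifiably crystalline but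
     have labelled weights `{0,0}` on paper (not `Nodup`), and nothing else irreducible is
     certifiable. So the hypothesis side of any refutation is blocked independently of
     pro-modularity.
   * `IsLabelledHodgeTateRegular` = `Nodup` of `jumpMultiset (dim Fil^• D_τ)`: genuine on de Rham
     `ρ`, VACUOUS on period-less `ρ` (§1d', proved). Not a junk door for a refutation (it only
     makes the hypothesis easier, and the crystalline conjunct still bites).
   * `IsOdd` quantifies over genuine complex conjugations (`IsComplexConjugation φ c`:
     `c` acts as `conj` under an embedding `K̄ → ℂ` over `φ`; `c ≠ 1` proved in the tree), so
     `IsOdd` is neither vacuous nor unsatisfiable (`det ρ(c) = -1` is consistent: `c² = 1`).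
   * `IsPadicallyAutomorphic`, `heckeFrobPoly`, `CuspidalAutomorphicRepData` (non-unitary central
     characters allowed, so L-algebraic twists are data), `SatakeFrobCompatibleAt` (arithmetic
     Frobenius, roots `ι⁻¹(α_j⁻¹)`): audited by the sibling disprover (ProModularOrdinaryClassical
     Disproof §5, §8.2) for general `F`; nothing to add.
3. VACUITY / TRIVIALITY: every binder inhabited (§3); hypotheses jointly satisfiable on paper
   (any `ρ_f`, `f` a Hilbert newform of cohomological weight and level prime to `p`) but not
   certifiable in Lean (item 2); conclusion not closable by `simp/aesop/exact?` (needs a `π`).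
4. JUNK MODELS: `F = ℚ` is inside and harmless (§3, in print); `p ∈ {5, 7, …}`; `n` fixed; no
   degenerate rank, no empty index set, no `n = 0` door (cf. the `OrdinaryPrimeTransport`
   refutation) — all parameters pinned.
5. HYPOTHESIS MUTATION (§1): `hunr` decoration (proved); pro-modular / odd / HT-regular /
   `5 ≤ p` / `p ∤ disc` / totally real / crystalline-vs-de-Rham: each deletion is still a
   corollary of `Langlands` (proved) — method-only; irreducible and crystalline: load-bearing for
   truth with honest paper witnesses (Eisenstein `H⁰` point; cyclotomic-twist family over `ℚ`).
6. STRENGTHENINGS (§2): all-places Satake matching is false on paper (ramified classical `ρ`),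
   formal half proved.
7. LITERATURE (negatives/positives): `ledger negatives --problem Langlands` — 3 entries
   (SplitPrimeInduction deinduction, OrdinaryPrimeTransport `n = 0`, K3 anchor), none related;
   barrier catalogue (11 files): `NonRegularWeightBarrier(Narrow)` constrains the METHOD at
   irregular weight only (the crux assumes regular), `ModPLanglandsGL2BeyondQp` /
   `PaskunasCentreFinitenessFails` / `PatchingLocalComponentBarrier` concern the engine crux and
   patching, not the truth of the exit; no printed counterexample to Fontaine–Mazur for `GL₂` over
   a totally real field exists. Positive side (in print): `F = ℚ` (Emerton 2011; Pan II, Ann.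
   Math. 203 (2026)); parallel weight over any totally real `F` (Jiang, arXiv:2605.18426,
   Thm. 1.1.1, under `H̃^d[χ] ≠ 0` — note the tree's `IsPadicallyAutomorphic` is "continuous point
   of `𝕋(K^p)`", and "point ⇒ `H̃^d(K^p, L)[χ] ≠ 0`" is itself a (Hochschild–Serre / Pan 2026
   vanishing-below-middle-degree) glue step the provers must supply); Qiu–Su arXiv:2505.10290
   (unitary Shimura curves, `σ`-de Rham ⇒ classical). searchd (local index) reset the connection
   once (05:0xZ); arXiv remote answered.

WHY IT RESISTS: `crux_of_langlands`. The crux is conjunct (B) of the summit restricted to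
{`n = 2`, `F` totally real, `p ≥ 5` unramified, odd, crystalline HT-regular} and further weakened
by pro-modularity; a witness against it is an irreducible geometric `ρ` matched by no cuspidal
`π`, i.e. a counterexample to Fontaine–Mazur–Langlands for `GL₂` over a totally real field in the
most classical sector there is (where, for `F = ℚ`, it is a theorem). Formally, moreover, neither
side of a witness is constructible: no non-Eisenstein point of the constructed `𝕋(K^p)` can be
exhibited, and no irreducible `ρ` can be certified crystalline-regular for the `ε`-pinned datum.

NEXT (re-arm on line pick / skeleton): the refutable statements of this corner are the LINE's
stubs, not the crux — expected shapes (route file, TWO-LAYER PLAN): `OverconvergentOfProModular`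
(continuous point of `𝕋(K^p)` ⇒ finite-slope overconvergent eigenform with Galois representation
`ρ`: attack (i) "point of `𝕋` ⇒ eigenvector in `H̃^d`" at Eisenstein-adjacent points, (ii) the
non-zero Jacquet module for `F_v ≠ ℚ_p`, (iii) INFINITE-slope points — a crystalline `ρ` whose
point is not of finite slope at some `v` would break a stub typed "∃ finite-slope refinement");
`SmallSlopeClassical` (attack critical slopes at non-parallel weight: numerically critical
refinements exist at some label as soon as the weight is far from parallel — demand companion
points in the stub or it is false as typed). Also for the lead: by §1a drop `hunr`; by §0 the exit
may equivalently be typed with de Rham in place of crystalline if that eases gluing with (B).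

HAZARD FOR EVERY LINE (recorded for the lead; the first stub to attack when filed): the crux's
pro-modularity is "SYSTEM OF EIGENVALUES = continuous point `x` of `𝕋(K^p)`"
(`TameLevel.IsPadicallyAutomorphic`), whereas every classicality theorem in print consumes
"OCCURRENCE": `Hom_{Γ}(ρ, H̃^d(K^p, E)) ≠ 0` (Pan II, arXiv:2209.06366 Thm. 1.1.2 (1), read p. 2:
"ρ appears in H̃¹(K^p, E), i.e. Hom_{E[G_ℚ]}(ρ, H̃¹(K^p, E)) ≠ 0"; Jiang Thm. 1.1.1 (1):
`H̃^d(K^p, L)[χ] ≠ 0`). The passage point ⇒ occurrence-in-degree-`d` is harmless at a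
non-Eisenstein `𝔪` (completed cohomology of the Hilbert modular variety localised at `𝔪` is
concentrated in degree `d`) but NOT in this route's sector: at an EISENSTEIN `𝔪` (ρ̄^ss = χ̄_a ⊕ χ̄_b)
`H̃^i(K^p)_𝔪 ≠ 0` for `i < d` (boundary / `H⁰` classes carry the Eisenstein eigensystem), the big
Hecke algebra of the crux is built from ALL degrees `i`, and a point of `𝕋(K^p)_𝔪` may a priori be
supported in degrees `< d` only. A stub "point ⇒ `H̃^d[𝔭_x] ≠ 0`" typed without an argument that an
IRREDUCIBLE `ρ_x` cannot live on the boundary strata alone is the line's first refutable statement;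
its honest form needs the irreducibility of `ρ` (boundary eigensystems are reducible) and a
degree-bookkeeping lemma (Pan, "Completed cohomology of Hilbert modular varieties below middle
degree", 2026, cited by Jiang as [Pan2026HilbertVanish], coming soon).
-/

end Summit.Langlands.Langlands.Cruxes.CrystallineProModularClassical.Disproof
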